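import Summits.ResolutionOfSingularities.ResolutionOfSingularities.Theorems.EquisingularLiftEquisingularLiftNatDepthIsoHypPoint
import Summits.ResolutionOfSingularities.ResolutionOfSingularities.Theorems.EquisingularLiftEquisingularLiftNatTwoStepOpen
import HarnessLib

/-!
# [OURS] THE TWO-LEVEL INSTANCE OF THE DEPTH-GRADED DESCENT: one-step (level `0`) / two-step (levels `≥ 1`) — and the `ξ`-free one-or-two-step theorem
# (cruxes `Theses.EquisingularLift.EquisingularLiftNat` / `…NatThree`, stmt-ResolutionOfSingularities-20038 / -20148)

[OURS · leafhand-res-equisingularlift-10 g1, 2026-08-31; cell `pub/decomp-res`] AI-produced, weaker than expert review; NOT a statement of any manuscript;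
nothing here proves resolution of singularities in positive characteristic.  DEF-FREE helper; no `sorry`; standard axioms; ZERO named hypotheses.

✓ `isoHypPoint_of_finiteDepthPoints` (p831199) takes an ABSTRACT depth-graded point-property `D` with UNFOLDING (`hDstep`) and LOCALITY (`hDloc`).  This file
CERTIFIES that the two hypotheses are jointly satisfiable by the intended kind of instance — the two-level family (spelled inline, no definition)

  `D d Γ y := (d = 0 → y is ONE-STEP on Γ) ∧ (d ≠ 0 → y is TWO-STEP on Γ)`

* ★ `twoLevel_step` — UNFOLDING: level `0` unfolds with the empty exceptional set, levels `≥ 1` unfold to closed one-step (= level-`0`) points;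
* ★ `twoLevel_loc` — LOCALITY `iff`: ✓ `PointChain.oneStepAt_iff_of_isIso_morphismRestrict`, ✓ `PointChain.twoStepAt_iff_of_isIso_morphismRestrict` (p831200);
* ★★★ `isoHypPoint_of_oneOrTwoStepPoints` — **`k = k̄`, `H` integral, `ι : H ↪ ℙⁿ_k` a closed immersion, the non-regular points of `H` a finite set `S` of
  points with closed images, each ONE-STEP OR TWO-STEP ⟹ `IsoHypPoint k n H ι`** — the `ξ`-free, single-set form of ✓ `isoHypPoint_of_twoStepPoints` (p831031),
  now a one-line instance of the depth-graded descent.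

Honest label: closes no registered stub (the registered isolated residual carries `¬ IsoHypPoint`; this certifies further `H` it excludes).

References: [StacksProject, Tags 080E, 02OS]; [Hartshorne1977, II Ex. 7.12]; [GortzWedhorn2020, Prop. 13.91] — through the cited tree files.
-/

set_option linter.dupNamespace false -- mandated namespace `Summit.<Summit>.<Problem>` of this single-conjunct summit

noncomputable section

open CategoryTheory CategoryTheory.Limits AlgebraicGeometry TopologicalSpace
open Literature.AlgebraicGeometry.Resolution Literature.AlgebraicGeometry.Motives
open AlgebraicGeometry.Scheme.IdealSheafData

namespace Summit.ResolutionOfSingularities.ResolutionOfSingularities.Cruxes.EquisingularLiftNat.Sections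

/-- ★ **UNFOLDING for the two-level family** `D d Γ y := (d = 0 → one-step) ∧ (d ≠ 0 → two-step)`: a blow-up at a level-`0` point is regular over it (empty
exceptional set); a blow-up at a level-`≥ 1` point is regular over it except at finitely many closed one-step points, which are level-`0` points. [OURS] -/
theorem twoLevel_step : ∀ (d : ℕ) (Γ : Scheme.{0}) (y : Γ),
    ((d = 0 → ∀ (hy : IsClosed (({y} : Set Γ))) (Z : Scheme.{0}) (τ : Z ⟶ Γ), IsBlowup τ (vanishingIdeal ⟨{y}, hy⟩) →
        ∀ z : Z, τ z = y → IsRegularLocalRing (Z.presheaf.stalk z)) ∧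
      (d ≠ 0 → ∀ (hy : IsClosed (({y} : Set Γ))) (Z : Scheme.{0}) (τ : Z ⟶ Γ), IsBlowup τ (vanishingIdeal ⟨{y}, hy⟩) →
        ∃ S' : Finset Z, (∀ z : Z, τ z = y → z ∉ S' → IsRegularLocalRing (Z.presheaf.stalk z)) ∧
          ∀ z ∈ S', τ z = y ∧ ∃ hz : IsClosed (({z} : Set Z)), ∀ (Z' : Scheme.{0}) (τ' : Z' ⟶ Z),
            IsBlowup τ' (vanishingIdeal ⟨{z}, hz⟩) → ∀ z' : Z', τ' z' = z → IsRegularLocalRing (Z'.presheaf.stalk z'))) →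
    ∀ (hy : IsClosed (({y} : Set Γ))) (Z : Scheme.{0}) (τ : Z ⟶ Γ), IsBlowup τ (vanishingIdeal ⟨{y}, hy⟩) →
      ∃ S' : Finset Z, (∀ z : Z, τ z = y → z ∉ S' → IsRegularLocalRing (Z.presheaf.stalk z)) ∧
        ∀ z ∈ S', τ z = y ∧ IsClosed (({z} : Set Z)) ∧ ∃ d' < d,
    ((d' = 0 → ∀ (hz : IsClosed (({z} : Set Z))) (W : Scheme.{0}) (φ : W ⟶ Z), IsBlowup φ (vanishingIdeal ⟨{z}, hz⟩) →
        ∀ w : W, φ w = z → IsRegularLocalRing (W.presheaf.stalk w)) ∧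
      (d' ≠ 0 → ∀ (hz : IsClosed (({z} : Set Z))) (W : Scheme.{0}) (φ : W ⟶ Z), IsBlowup φ (vanishingIdeal ⟨{z}, hz⟩) →
        ∃ S' : Finset W, (∀ w : W, φ w = z → w ∉ S' → IsRegularLocalRing (W.presheaf.stalk w)) ∧
          ∀ w ∈ S', φ w = z ∧ ∃ hw : IsClosed (({w} : Set W)), ∀ (W' : Scheme.{0}) (φ' : W' ⟶ W),
            IsBlowup φ' (vanishingIdeal ⟨{w}, hw⟩) → ∀ w' : W', φ' w' = w → IsRegularLocalRing (W'.presheaf.stalk w'))) := by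
  classical
  intro d Γ y hD hy Z τ hτ
  rcases Nat.eq_zero_or_pos d with hd | hd
  · -- level `0`: one-step, empty exceptional set
    refine ⟨∅, fun z hz _ => hD.1 hd hy Z τ hτ z hz, fun z hz => absurd hz (Finset.notMem_empty z)⟩
  · -- level `≥ 1`: two-step, the exceptional one-step points are level-`0` points
    obtain ⟨S', hreg, hS'⟩ := hD.2 (by omega) hy Z τ hτ
    refine ⟨S', hreg, fun z hz => ?_⟩
    obtain ⟨hτz, hzcl, hone⟩ := hS' z hz
    refine ⟨hτz, hzcl, 0, hd, fun _ hz' W φ hφ w hw => hone W φ hφ w hw, fun h => absurd rfl h⟩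

/-- ★ **LOCALITY (`iff`) for the two-level family**: along `ρ : Γ₂ → Γ`, an isomorphism over an open `U ∋ y`, for closed points `y₂ ↦ y`
(✓ `PointChain.oneStepAt_iff_of_isIso_morphismRestrict`, ✓ `PointChain.twoStepAt_iff_of_isIso_morphismRestrict`). [OURS] [cite: GortzWedhorn2020, (13.19)] -/
theorem twoLevel_loc : ∀ (d : ℕ) (Γ Γ₂ : Scheme.{0}) (ρ : Γ₂ ⟶ Γ) (U : Γ.Opens), IsIso (ρ ∣_ U) → ∀ y : Γ, y ∈ U → IsClosed (({y} : Set Γ)) →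
    ∀ y₂ : Γ₂, ρ y₂ = y → IsClosed (({y₂} : Set Γ₂)) →
    (((d = 0 → ∀ (hy : IsClosed (({y} : Set Γ))) (Z : Scheme.{0}) (τ : Z ⟶ Γ), IsBlowup τ (vanishingIdeal ⟨{y}, hy⟩) →
        ∀ z : Z, τ z = y → IsRegularLocalRing (Z.presheaf.stalk z)) ∧
      (d ≠ 0 → ∀ (hy : IsClosed (({y} : Set Γ))) (Z : Scheme.{0}) (τ : Z ⟶ Γ), IsBlowup τ (vanishingIdeal ⟨{y}, hy⟩) →
        ∃ S' : Finset Z, (∀ z : Z, τ z = y → z ∉ S' → IsRegularLocalRing (Z.presheaf.stalk z)) ∧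
          ∀ z ∈ S', τ z = y ∧ ∃ hz : IsClosed (({z} : Set Z)), ∀ (Z' : Scheme.{0}) (τ' : Z' ⟶ Z),
            IsBlowup τ' (vanishingIdeal ⟨{z}, hz⟩) → ∀ z' : Z', τ' z' = z → IsRegularLocalRing (Z'.presheaf.stalk z'))) ↔
     ((d = 0 → ∀ (hy : IsClosed (({y₂} : Set Γ₂))) (Z : Scheme.{0}) (τ : Z ⟶ Γ₂), IsBlowup τ (vanishingIdeal ⟨{y₂}, hy⟩) →
        ∀ z : Z, τ z = y₂ → IsRegularLocalRing (Z.presheaf.stalk z)) ∧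
      (d ≠ 0 → ∀ (hy : IsClosed (({y₂} : Set Γ₂))) (Z : Scheme.{0}) (τ : Z ⟶ Γ₂), IsBlowup τ (vanishingIdeal ⟨{y₂}, hy⟩) →
        ∃ S' : Finset Z, (∀ z : Z, τ z = y₂ → z ∉ S' → IsRegularLocalRing (Z.presheaf.stalk z)) ∧
          ∀ z ∈ S', τ z = y₂ ∧ ∃ hz : IsClosed (({z} : Set Z)), ∀ (Z' : Scheme.{0}) (τ' : Z' ⟶ Z),
            IsBlowup τ' (vanishingIdeal ⟨{z}, hz⟩) → ∀ z' : Z', τ' z' = z → IsRegularLocalRing (Z'.presheaf.stalk z')))) := by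
  intro d Γ Γ₂ ρ U hρ y hyU hy y₂ hy₂ hy₂cl
  haveI := hρ
  refine and_congr (imp_congr_right fun _ => ?_) (imp_congr_right fun _ => ?_)
  · constructor
    · intro h hy₂' Z τ hτ
      exact (PointChain.oneStepAt_iff_of_isIso_morphismRestrict ρ U hyU hy hy₂ hy₂').mp (h hy) Z τ hτ
    · intro h hy' Z τ hτ
      exact (PointChain.oneStepAt_iff_of_isIso_morphismRestrict ρ U hyU hy' hy₂ hy₂cl).mpr (h hy₂cl) Z τ hτ
  · constructor
    · intro h hy₂' Z τ hτ
      exact (PointChain.twoStepAt_iff_of_isIso_morphismRestrict ρ U hyU hy hy₂ hy₂').mp (h hy) Z τ hτ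
    · intro h hy' Z τ hτ
      exact (PointChain.twoStepAt_iff_of_isIso_morphismRestrict ρ U hyU hy' hy₂ hy₂cl).mpr (h hy₂cl) Z τ hτ

/-- ★★★ **FINITELY MANY ONE-STEP OR TWO-STEP SINGULAR POINTS ⟹ `IsoHypPoint`, `ξ`-free single-set form.**  `k` algebraically closed, `H` integral,
`ι : H ↪ ℙⁿ_k` a closed immersion; `S` a finite set of points of `H` with closed images such that `H` is regular exactly off `S`, every `x ∈ S` ONE-STEP («every
blow-up of `H` at the reduced point `x` is regular over `x`») OR TWO-STEP («… regular over `x` except at finitely many closed one-step points»).  Then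
`IsoHypPoint k n H ι` — ✓ `isoHypPoint_of_finiteDepthPoints` for the two-level family (`twoLevel_step`, `twoLevel_loc`). [OURS] [cite: StacksProject, Tag 080E]
[cite: Hartshorne1977, II Ex. 7.12] -/
theorem isoHypPoint_of_oneOrTwoStepPoints (k : Type) [Field k] [IsAlgClosed k] (n : ℕ) (H : Scheme.{0})
    (ι : H ⟶ (projectiveSpace n k).left) [IsClosedImmersion ι] [IsIntegral H]
    (S : Finset H)
    (hcl : ∀ x ∈ S, IsClosed (({ι x} : Set (projectiveSpace n k).left)))
    (hsing : ∀ x ∈ S, ¬ IsRegularLocalRing (H.presheaf.stalk x))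
    (hreg : ∀ x : H, x ∉ S → IsRegularLocalRing (H.presheaf.stalk x))
    (hstep : ∀ x ∈ S,
      (∀ (hx : IsClosed (({x} : Set H))) (Z : Scheme.{0}) (τ : Z ⟶ H), IsBlowup τ (vanishingIdeal ⟨{x}, hx⟩) →
        ∀ z : Z, τ z = x → IsRegularLocalRing (Z.presheaf.stalk z)) ∨
      (∀ (hx : IsClosed (({x} : Set H))) (Z : Scheme.{0}) (τ : Z ⟶ H), IsBlowup τ (vanishingIdeal ⟨{x}, hx⟩) →
        ∃ S' : Finset Z, (∀ z : Z, τ z = x → z ∉ S' → IsRegularLocalRing (Z.presheaf.stalk z)) ∧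
          ∀ z ∈ S', τ z = x ∧ ∃ hz : IsClosed (({z} : Set Z)), ∀ (Z' : Scheme.{0}) (τ' : Z' ⟶ Z),
            IsBlowup τ' (vanishingIdeal ⟨{z}, hz⟩) → ∀ z' : Z', τ' z' = z → IsRegularLocalRing (Z'.presheaf.stalk z'))) :
    IsoHypPoint k n H ι := by
  refine isoHypPoint_of_finiteDepthPoints k n H ι
    (fun d Γ y =>
      ((d = 0 → ∀ (hy : IsClosed (({y} : Set Γ))) (Z : Scheme.{0}) (τ : Z ⟶ Γ), IsBlowup τ (vanishingIdeal ⟨{y}, hy⟩) →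
        ∀ z : Z, τ z = y → IsRegularLocalRing (Z.presheaf.stalk z)) ∧
      (d ≠ 0 → ∀ (hy : IsClosed (({y} : Set Γ))) (Z : Scheme.{0}) (τ : Z ⟶ Γ), IsBlowup τ (vanishingIdeal ⟨{y}, hy⟩) →
        ∃ S' : Finset Z, (∀ z : Z, τ z = y → z ∉ S' → IsRegularLocalRing (Z.presheaf.stalk z)) ∧
          ∀ z ∈ S', τ z = y ∧ ∃ hz : IsClosed (({z} : Set Z)), ∀ (Z' : Scheme.{0}) (τ' : Z' ⟶ Z),
            IsBlowup τ' (vanishingIdeal ⟨{z}, hz⟩) → ∀ z' : Z', τ' z' = z → IsRegularLocalRing (Z'.presheaf.stalk z'))))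
    twoLevel_step twoLevel_loc S hcl hsing hreg fun x hx => ?_
  rcases hstep x hx with h | h
  · exact ⟨0, fun _ => h, fun h0 => absurd rfl h0⟩
  · exact ⟨1, fun h1 => absurd h1 one_ne_zero, fun _ => h⟩

end Summit.ResolutionOfSingularities.ResolutionOfSingularities.Cruxes.EquisingularLiftNat.Sections

end
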